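import Summits.BirchSwinnertonDyer.Rank1Residual.X12.CMTamagawaThree
import Summits.BirchSwinnertonDyer.Rank1Residual.X12.InertCoreInstancesD
import Summits.BirchSwinnertonDyer.Rank1Residual.X12.InertCoreInstancesE
import Summits.BirchSwinnertonDyer.Rank1Residual.X12.InertCoreInstancesF
import Summits.BirchSwinnertonDyer.Rank1Residual.X12.InertCoreInstancesH
import Summits.BirchSwinnertonDyer.Rank1Residual.X12.ThreeIrrRecords
import Literature.NumberTheory.EllipticCurves.OrdinaryPrimesProofs
import Literature.NumberTheory.EllipticCurves.ComplexMultiplicationHasCMThirteenProofs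
import HarnessLib

/-!
# X12, the `T-KOB13@3` WINDOW (CM, `r_an = 1`, `3` GOOD inert; `N < 2·10⁴`): the 32 classes —
# models and model facts (A) for the per-class records of `CMGoodThreeRecordsB.lean`
# (cell `b2b-bsdres`, unit `b2b-bsdres-x1b`, gen 22)

HONEST FRAMING (cell `b2b-bsdres`, run/shared/lean/b2b/bsd-rank1-residual/, verbatim in every
file): the goal of the cell is to DELETE the COMBINATION-SHAPED residual classes of the
Birch–Swinnerton-Dyer formula for ALL analytic-rank `≤ 1` elliptic curves over `ℚ` — "full BSD
formula for every rank `≤ 1` curve in class `C`" assembled STRICTLY from published theorems — so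
that the rank-`≤ 1` remainder becomes exactly the CONSTRUCTION-SHAPED classes, which are TYPED
(missing-input `Prop`s), NOT attempted. This is not "finishing BSD". Unit `b2b-bsdres-x1b` (X12
prover owner), generation 22; research route, no claim beyond the stated class; X12 REMAINS
CONSTRUCTION-SHAPED; nothing is booked here (the lane books, the referee rules).

PER-CLASS records in the style of `X12/InertCoreInstances{A..H}.lean` (gen 15), for the datum-free
route T-KR3G of `X12/CMTamagawaThree.lean` (p246583,
`X12.bsdp_three_of_hasCM_rankOne_of_good_of_shaAn_unit`: CM + `r_an = 1` + good reduction at `3` +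
`ord₃ #Ш_an = 0` ⟹ `BSD(E,3)`, binders = published named facts only). This part (A) holds the DATA:
Cremona's minimal model of curve `1` of each of the 32 window classes of the `T-KOB13@3` hold
(x1b class ledger after referee-A ROUND 195; `HOME/b2b-bsdres-x1b/gen21/tkr3g/TKR3G-KOB13-225.tsv`,
rows `N < 2·10⁴`; 23 of them have `N < 10⁴`), and per model the KERNEL facts the record consumes:
elliptic and globally minimal (bounded Kraus/Silverman criterion, `decide`), `HasCM` (from
`j ∈ {1728, −3375, −884736, −884736000, −147197952000}`), and GOOD reduction at `3` from
`3 ∤ Δ_min` (`good_three_of_Δ_eq`). Twenty of the 32 models already exist in the tree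
(`InertCoreInstances{D,E,F,H}`, `ThreeIrrRecords`, `GoodTwistRecordsD7D8`) and are REUSED by name;
twelve (`K = ℚ(i)`, `y² = x³ + Ax`) are new definitions here. Definitions are Cremona's models
(data); theorems only otherwise; no named fact. What is left per class is exactly the lane's
certified data `r_an = 1` and `ord₃ #Ш_an = 0` (two engines on all 558 members of the 225 held
classes: x1b gen 21 kit j114903 vs Cremona `allbsd`, AGREE 558/558).
-/

set_option autoImplicit false

noncomputable section

open scoped Classical

open WeierstrassCurve Literature.NumberTheory.EllipticCurves
  Literature.NumberTheory.EllipticCurves.Rank1Residual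
  Summit.BirchSwinnertonDyer.BirchSwinnertonDyer.Rank1Residual.X11RankOne
  Summit.BirchSwinnertonDyer.Rank1Residual.X11b

namespace Summit.BirchSwinnertonDyer.Rank1Residual.X12

/-! ## §0 Kit: good reduction at `3` read off a globally minimal model -/

/-- **Good reduction at `3` read off a globally minimal model**: `W.Δ = D ∈ ℤ` with `3 ∤ D` ⟹
`good(3)` (a globally minimal equation has `Δ = Δ_min`, and `p ∤ Δ_min` ⟹ good reduction at `p`,
tree `hasGoodReductionAtPrime_of_not_dvd`). [cite: SilvermanAEC2009, VII.1 Remark 1.1 and VII.5 Prop. 5.1(a)] -/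
theorem good_three_of_Δ_eq (W : WeierstrassCurve ℚ) [W.IsElliptic] [W.IsGloballyMinimal] {D : ℤ}
    (hΔ : W.Δ = D) (h3 : ¬ (3 : ℤ) ∣ D) : Good W 3 := by
  refine hasGoodReductionAtPrime_of_not_dvd W 3 ?_
  have h : (minimalDiscriminantInt W : ℚ) = (D : ℚ) := by rw [cast_minimalDiscriminantInt, hΔ]
  rwa [Int.cast_inj.mp h]

/-- `HasCM` read off `c₆ = 0` (`j = 1728`, CM by `ℤ[i]`) for the model `y² = x³ + Ax`.
[cite: SilvermanAEC2009, App. C §11, Example 11.3.1] -/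
theorem hasCM_of_eq_quartic (W : WeierstrassCurve ℚ) [W.IsElliptic] (A : ℚ)
    (hW : W = ⟨0, 0, 0, A, 0⟩) : W.HasCM :=
  hasCM_of_j_eq_1728 W (j_eq_1728_of_c₆_eq_zero W (by rw [hW]; exact (Δ_c₆_quartic A).2))

/-- Good reduction at `3` for the model `y² = x³ + Ax` with `A = D ∈ ℤ`, `3 ∤ D` (`Δ = −64A³`).
[cite: SilvermanAEC2009, VII.5 Prop. 5.1(a)] -/
theorem good_three_of_eq_quartic (W : WeierstrassCurve ℚ) [W.IsElliptic] [W.IsGloballyMinimal]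
    (D : ℤ) (hW : W = ⟨0, 0, 0, (D : ℚ), 0⟩) (h3 : ¬ (3 : ℤ) ∣ D) : Good W 3 := by
  refine good_three_of_Δ_eq W (D := -(64 * D ^ 3))
    (by rw [hW, (Δ_c₆_quartic (D : ℚ)).1]; push_cast; ring) ?_
  intro h
  have h' : (3 : ℤ) ∣ 64 * D ^ 3 := dvd_neg.mp h
  rcases Int.prime_three.dvd_or_dvd h' with h64 | hD3
  · norm_num at h64
  · exact h3 (Int.prime_three.dvd_of_dvd_pow hD3)

namespace Records

/-! ## §1 The twelve new models (`K = ℚ(i)`, `y² = x³ + Ax`, curve `1` of its class) -/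

/-- Cremona `256b1 = [0, 0, 0, -2, 0]`: `y² = x³ − 2x` (`N = 256 = 2⁸`, `j = 1728`, CM by `ℤ[i]`,
`3` good INERT in `K = ℚ(i)`; `Δ = 2⁹`). [cite: Cremona1997, Table 1 (curve 256b1)] -/
def c256b1 : WeierstrassCurve ℚ := ⟨0, 0, 0, -2, 0⟩

/-- `256b1` is an elliptic curve (`Δ ≠ 0`). [cite: SilvermanAEC2009, III.1] -/
instance isElliptic_c256b1 : c256b1.IsElliptic := by
  have h := isElliptic_of_discOf_ne_zero 0 0 0 (-2) 0 (by decide); norm_num at h; exact h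

set_option maxRecDepth 100000 in
/-- `[0, 0, 0, -2, 0]` is globally minimal (Silverman/Kraus bounded criterion; kernel-decided).
[cite: SilvermanAEC2009, VII.1 Remark 1.1] [cite: Kraus1989, Prop. 2] -/
instance isGloballyMinimal_c256b1 : c256b1.IsGloballyMinimal := by
  have h := isGloballyMinimal_of_krausCriterion_bounded 0 0 0 (-2) 0 (by decide) (by decide)
    (by decide +kernel)
  norm_num at h; exact h

/-- Cremona `800a1 = [0, 0, 0, -25, 0]`: `y² = x³ − 25x` (`N = 800 = 2⁵·5²`, `j = 1728`, CM by `ℤ[i]`,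
`3` good INERT in `K = ℚ(i)`; `Δ = 2⁶·5⁶`). [cite: Cremona1997, Table 1 (curve 800a1)] -/
def c800a1 : WeierstrassCurve ℚ := ⟨0, 0, 0, -25, 0⟩

/-- `800a1` is an elliptic curve (`Δ ≠ 0`). [cite: SilvermanAEC2009, III.1] -/
instance isElliptic_c800a1 : c800a1.IsElliptic := by
  have h := isElliptic_of_discOf_ne_zero 0 0 0 (-25) 0 (by decide); norm_num at h; exact h

set_option maxRecDepth 100000 in
/-- `[0, 0, 0, -25, 0]` is globally minimal (Silverman/Kraus bounded criterion; kernel-decided).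
[cite: SilvermanAEC2009, VII.1 Remark 1.1] [cite: Kraus1989, Prop. 2] -/
instance isGloballyMinimal_c800a1 : c800a1.IsGloballyMinimal := by
  have h := isGloballyMinimal_of_krausCriterion_bounded 0 0 0 (-25) 0 (by decide) (by decide)
    (by decide +kernel)
  norm_num at h; exact h

/-- Cremona `800h1 = [0, 0, 0, -5, 0]`: `y² = x³ − 5x` (`N = 800 = 2⁵·5²`, `j = 1728`, CM by `ℤ[i]`,
`3` good INERT in `K = ℚ(i)`; `Δ = 2⁶·5³`). [cite: Cremona1997, Table 1 (curve 800h1)] -/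
def c800h1 : WeierstrassCurve ℚ := ⟨0, 0, 0, -5, 0⟩

/-- `800h1` is an elliptic curve (`Δ ≠ 0`). [cite: SilvermanAEC2009, III.1] -/
instance isElliptic_c800h1 : c800h1.IsElliptic := by
  have h := isElliptic_of_discOf_ne_zero 0 0 0 (-5) 0 (by decide); norm_num at h; exact h

set_option maxRecDepth 100000 in
/-- `[0, 0, 0, -5, 0]` is globally minimal (Silverman/Kraus bounded criterion; kernel-decided).
[cite: SilvermanAEC2009, VII.1 Remark 1.1] [cite: Kraus1989, Prop. 2] -/
instance isGloballyMinimal_c800h1 : c800h1.IsGloballyMinimal := by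
  have h := isGloballyMinimal_of_krausCriterion_bounded 0 0 0 (-5) 0 (by decide) (by decide)
    (by decide +kernel)
  norm_num at h; exact h

/-- Cremona `1600t1 = [0, 0, 0, 5, 0]`: `y² = x³ + 5x` (`N = 1600 = 2⁶·5²`, `j = 1728`, CM by `ℤ[i]`,
`3` good INERT in `K = ℚ(i)`; `Δ = −2⁶·5³`). [cite: Cremona1997, Table 1 (curve 1600t1)] -/
def c1600t1 : WeierstrassCurve ℚ := ⟨0, 0, 0, 5, 0⟩

/-- `1600t1` is an elliptic curve (`Δ ≠ 0`). [cite: SilvermanAEC2009, III.1] -/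
instance isElliptic_c1600t1 : c1600t1.IsElliptic := by
  have h := isElliptic_of_discOf_ne_zero 0 0 0 5 0 (by decide); norm_num at h; exact h

set_option maxRecDepth 100000 in
/-- `[0, 0, 0, 5, 0]` is globally minimal (Silverman/Kraus bounded criterion; kernel-decided).
[cite: SilvermanAEC2009, VII.1 Remark 1.1] [cite: Kraus1989, Prop. 2] -/
instance isGloballyMinimal_c1600t1 : c1600t1.IsGloballyMinimal := by
  have h := isGloballyMinimal_of_krausCriterion_bounded 0 0 0 5 0 (by decide) (by decide)
    (by decide +kernel)
  norm_num at h; exact h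

/-- Cremona `1600u1 = [0, 0, 0, 125, 0]`: `y² = x³ + 125x` (`N = 1600 = 2⁶·5²`, `j = 1728`, CM by `ℤ[i]`,
`3` good INERT in `K = ℚ(i)`; `Δ = −2⁶·5⁹`). [cite: Cremona1997, Table 1 (curve 1600u1)] -/
def c1600u1 : WeierstrassCurve ℚ := ⟨0, 0, 0, 125, 0⟩

/-- `1600u1` is an elliptic curve (`Δ ≠ 0`). [cite: SilvermanAEC2009, III.1] -/
instance isElliptic_c1600u1 : c1600u1.IsElliptic := by
  have h := isElliptic_of_discOf_ne_zero 0 0 0 125 0 (by decide); norm_num at h; exact h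

set_option maxRecDepth 100000 in
/-- `[0, 0, 0, 125, 0]` is globally minimal (Silverman/Kraus bounded criterion; kernel-decided).
[cite: SilvermanAEC2009, VII.1 Remark 1.1] [cite: Kraus1989, Prop. 2] -/
instance isGloballyMinimal_c1600u1 : c1600u1.IsGloballyMinimal := by
  have h := isGloballyMinimal_of_krausCriterion_bounded 0 0 0 125 0 (by decide) (by decide)
    (by decide +kernel)
  norm_num at h; exact h

/-- Cremona `5408a1 = [0, 0, 0, -169, 0]`: `y² = x³ − 169x` (`N = 5408 = 2⁵·13²`, `j = 1728`, CM by `ℤ[i]`,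
`3` good INERT in `K = ℚ(i)`; `Δ = 2⁶·13⁶`). [cite: Cremona1997, Table 1 (curve 5408a1)] -/
def c5408a1 : WeierstrassCurve ℚ := ⟨0, 0, 0, -169, 0⟩

/-- `5408a1` is an elliptic curve (`Δ ≠ 0`). [cite: SilvermanAEC2009, III.1] -/
instance isElliptic_c5408a1 : c5408a1.IsElliptic := by
  have h := isElliptic_of_discOf_ne_zero 0 0 0 (-169) 0 (by decide); norm_num at h; exact h

set_option maxRecDepth 100000 in
/-- `[0, 0, 0, -169, 0]` is globally minimal (Silverman/Kraus bounded criterion; kernel-decided).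
[cite: SilvermanAEC2009, VII.1 Remark 1.1] [cite: Kraus1989, Prop. 2] -/
instance isGloballyMinimal_c5408a1 : c5408a1.IsGloballyMinimal := by
  have h := isGloballyMinimal_of_krausCriterion_bounded 0 0 0 (-169) 0 (by decide) (by decide)
    (by decide +kernel)
  norm_num at h; exact h

/-- Cremona `5408k1 = [0, 0, 0, -2197, 0]`: `y² = x³ − 2197x` (`N = 5408 = 2⁵·13²`, `j = 1728`, CM by `ℤ[i]`,
`3` good INERT in `K = ℚ(i)`; `Δ = 2⁶·13⁹`). [cite: Cremona1997, Table 1 (curve 5408k1)] -/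
def c5408k1 : WeierstrassCurve ℚ := ⟨0, 0, 0, -2197, 0⟩

/-- `5408k1` is an elliptic curve (`Δ ≠ 0`). [cite: SilvermanAEC2009, III.1] -/
instance isElliptic_c5408k1 : c5408k1.IsElliptic := by
  have h := isElliptic_of_discOf_ne_zero 0 0 0 (-2197) 0 (by decide); norm_num at h; exact h

set_option maxRecDepth 100000 in
/-- `[0, 0, 0, -2197, 0]` is globally minimal (Silverman/Kraus bounded criterion; kernel-decided).
[cite: SilvermanAEC2009, VII.1 Remark 1.1] [cite: Kraus1989, Prop. 2] -/
instance isGloballyMinimal_c5408k1 : c5408k1.IsGloballyMinimal := by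
  have h := isGloballyMinimal_of_krausCriterion_bounded 0 0 0 (-2197) 0 (by decide) (by decide)
    (by decide +kernel)
  norm_num at h; exact h

/-- Cremona `6400a1 = [0, 0, 0, -50, 0]`: `y² = x³ − 50x` (`N = 6400 = 2⁸·5²`, `j = 1728`, CM by `ℤ[i]`,
`3` good INERT in `K = ℚ(i)`; `Δ = 2⁹·5⁶`). [cite: Cremona1997, Table 1 (curve 6400a1)] -/
def c6400a1 : WeierstrassCurve ℚ := ⟨0, 0, 0, -50, 0⟩

/-- `6400a1` is an elliptic curve (`Δ ≠ 0`). [cite: SilvermanAEC2009, III.1] -/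
instance isElliptic_c6400a1 : c6400a1.IsElliptic := by
  have h := isElliptic_of_discOf_ne_zero 0 0 0 (-50) 0 (by decide); norm_num at h; exact h

set_option maxRecDepth 100000 in
/-- `[0, 0, 0, -50, 0]` is globally minimal (Silverman/Kraus bounded criterion; kernel-decided).
[cite: SilvermanAEC2009, VII.1 Remark 1.1] [cite: Kraus1989, Prop. 2] -/
instance isGloballyMinimal_c6400a1 : c6400a1.IsGloballyMinimal := by
  have h := isGloballyMinimal_of_krausCriterion_bounded 0 0 0 (-50) 0 (by decide) (by decide)
    (by decide +kernel)
  norm_num at h; exact h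

/-- Cremona `6400s1 = [0, 0, 0, -250, 0]`: `y² = x³ − 250x` (`N = 6400 = 2⁸·5²`, `j = 1728`, CM by `ℤ[i]`,
`3` good INERT in `K = ℚ(i)`; `Δ = 2⁹·5⁹`). [cite: Cremona1997, Table 1 (curve 6400s1)] -/
def c6400s1 : WeierstrassCurve ℚ := ⟨0, 0, 0, -250, 0⟩

/-- `6400s1` is an elliptic curve (`Δ ≠ 0`). [cite: SilvermanAEC2009, III.1] -/
instance isElliptic_c6400s1 : c6400s1.IsElliptic := by
  have h := isElliptic_of_discOf_ne_zero 0 0 0 (-250) 0 (by decide); norm_num at h; exact h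

set_option maxRecDepth 100000 in
/-- `[0, 0, 0, -250, 0]` is globally minimal (Silverman/Kraus bounded criterion; kernel-decided).
[cite: SilvermanAEC2009, VII.1 Remark 1.1] [cite: Kraus1989, Prop. 2] -/
instance isGloballyMinimal_c6400s1 : c6400s1.IsGloballyMinimal := by
  have h := isGloballyMinimal_of_krausCriterion_bounded 0 0 0 (-250) 0 (by decide) (by decide)
    (by decide +kernel)
  norm_num at h; exact h

/-- Cremona `6400t1 = [0, 0, 0, -10, 0]`: `y² = x³ − 10x` (`N = 6400 = 2⁸·5²`, `j = 1728`, CM by `ℤ[i]`,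
`3` good INERT in `K = ℚ(i)`; `Δ = 2⁹·5³`). [cite: Cremona1997, Table 1 (curve 6400t1)] -/
def c6400t1 : WeierstrassCurve ℚ := ⟨0, 0, 0, -10, 0⟩

/-- `6400t1` is an elliptic curve (`Δ ≠ 0`). [cite: SilvermanAEC2009, III.1] -/
instance isElliptic_c6400t1 : c6400t1.IsElliptic := by
  have h := isElliptic_of_discOf_ne_zero 0 0 0 (-10) 0 (by decide); norm_num at h; exact h

set_option maxRecDepth 100000 in
/-- `[0, 0, 0, -10, 0]` is globally minimal (Silverman/Kraus bounded criterion; kernel-decided).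
[cite: SilvermanAEC2009, VII.1 Remark 1.1] [cite: Kraus1989, Prop. 2] -/
instance isGloballyMinimal_c6400t1 : c6400t1.IsGloballyMinimal := by
  have h := isGloballyMinimal_of_krausCriterion_bounded 0 0 0 (-10) 0 (by decide) (by decide)
    (by decide +kernel)
  norm_num at h; exact h

/-- Cremona `10816bl1 = [0, 0, 0, 2197, 0]`: `y² = x³ + 2197x` (`N = 10816 = 2⁶·13²`, `j = 1728`, CM by `ℤ[i]`,
`3` good INERT in `K = ℚ(i)`; `Δ = −2⁶·13⁹`). [cite: Cremona1997, Table 1 (curve 10816bl1)] -/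
def c10816bl1 : WeierstrassCurve ℚ := ⟨0, 0, 0, 2197, 0⟩

/-- `10816bl1` is an elliptic curve (`Δ ≠ 0`). [cite: SilvermanAEC2009, III.1] -/
instance isElliptic_c10816bl1 : c10816bl1.IsElliptic := by
  have h := isElliptic_of_discOf_ne_zero 0 0 0 2197 0 (by decide); norm_num at h; exact h

set_option maxRecDepth 100000 in
/-- `[0, 0, 0, 2197, 0]` is globally minimal (Silverman/Kraus bounded criterion; kernel-decided).
[cite: SilvermanAEC2009, VII.1 Remark 1.1] [cite: Kraus1989, Prop. 2] -/
instance isGloballyMinimal_c10816bl1 : c10816bl1.IsGloballyMinimal := by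
  have h := isGloballyMinimal_of_krausCriterion_bounded 0 0 0 2197 0 (by decide) (by decide)
    (by decide +kernel)
  norm_num at h; exact h

/-- Cremona `10816bm1 = [0, 0, 0, 13, 0]`: `y² = x³ + 13x` (`N = 10816 = 2⁶·13²`, `j = 1728`, CM by `ℤ[i]`,
`3` good INERT in `K = ℚ(i)`; `Δ = −2⁶·13³`). [cite: Cremona1997, Table 1 (curve 10816bm1)] -/
def c10816bm1 : WeierstrassCurve ℚ := ⟨0, 0, 0, 13, 0⟩

/-- `10816bm1` is an elliptic curve (`Δ ≠ 0`). [cite: SilvermanAEC2009, III.1] -/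
instance isElliptic_c10816bm1 : c10816bm1.IsElliptic := by
  have h := isElliptic_of_discOf_ne_zero 0 0 0 13 0 (by decide); norm_num at h; exact h

set_option maxRecDepth 100000 in
/-- `[0, 0, 0, 13, 0]` is globally minimal (Silverman/Kraus bounded criterion; kernel-decided).
[cite: SilvermanAEC2009, VII.1 Remark 1.1] [cite: Kraus1989, Prop. 2] -/
instance isGloballyMinimal_c10816bm1 : c10816bm1.IsGloballyMinimal := by
  have h := isGloballyMinimal_of_krausCriterion_bounded 0 0 0 13 0 (by decide) (by decide)
    (by decide +kernel)
  norm_num at h; exact h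

/-! ## §2 Global minimality of the three reused models of `ThreeIrrRecords.lean` that lack the instance -/

set_option maxRecDepth 100000 in
/-- `[0, 0, 0, −35, 98]` (Cremona `784h1`, `Δ = −2¹²·7³`, `c₆ = −2⁶·1323`, `−1323 ≡ 1 (mod 4)`) is
globally minimal: Kraus's pattern `c₆ = 2⁶L`, `L ≡ 1 (mod 4)` at `2`, Silverman elsewhere
(kernel-decided). [cite: Kraus1989, Prop. 2] [cite: SilvermanAEC2009, VII.1 Remark 1.1] -/
instance isGloballyMinimal_cremona784h1 : cremona784h1.IsGloballyMinimal := by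
  have h := isGloballyMinimal_of_krausCriterion_bounded₃ 0 0 0 (-35) 98 (by decide) (by decide)
    (by decide +kernel)
  norm_num at h
  exact h

set_option maxRecDepth 100000 in
/-- `[0, 0, 0, −140, 784]` (Cremona `3136r1`, `Δ = −2¹⁸·7³`, `c₄ = 2⁶·105`, `c₆ = −2⁹·1323`) is
globally minimal: Kraus's pattern `2⁸ ∤ c₄`, `2⁷ ∣ c₆` at `2`, Silverman elsewhere (kernel-decided).
[cite: Kraus1989, Prop. 2] [cite: SilvermanAEC2009, VII.1 Remark 1.1] -/
instance isGloballyMinimal_cremona3136r1 : cremona3136r1.IsGloballyMinimal := by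
  have h := isGloballyMinimal_of_krausCriterion_bounded 0 0 0 (-140) 784 (by decide) (by decide)
    (by decide +kernel)
  norm_num at h
  exact h

set_option maxRecDepth 100000 in
/-- `[1, −1, 1, −265, 2104]` (Cremona `5929e1`, `Δ = −7³·11⁶`) is globally minimal (Silverman's
criterion: `q¹² ∤ Δ` for every `q`; kernel-decided). [cite: SilvermanAEC2009, VII.1 Remark 1.1] -/
instance isGloballyMinimal_cremona5929e1 : cremona5929e1.IsGloballyMinimal := by
  have h := isGloballyMinimal_of_krausCriterion_bounded 1 (-1) 1 (-265) 2104 (by decide) (by decide)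
    (by decide +kernel)
  norm_num at h
  exact h

end Records

end Summit.BirchSwinnertonDyer.Rank1Residual.X12

end
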